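import Literature.AlgebraicGeometry.AbelianSchemes.AbelianSchemeHomDescentPolarized
import Literature.AlgebraicGeometry.AbelianSchemes.DualIsogenyMulN
import HarnessLib

/-!
# Cancelling a quasi-invertible cover on both sides of a polarisation identity: `c̄ ≫ X ≫ c̄^∨ = c̄ ≫ Y ≫ c̄^∨ ⇒ X = Y`
# ([MumfordAV1970] §7 Thm. 4, §15 Thm. 1; [SGA1] VIII Thm. 5.2)

Topic `Literature/AlgebraicGeometry/AbelianSchemes`, namespace `Literature.AlgebraicGeometry.AbelianSchemes.AbelianSchemeOver`.  THEOREMS ONLY (no definition, no named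
fact, no `instance`, no notation, no `sorry`).  Cell `hodgecm-mathlib` (D-0151), P6 «MOD», line L3 (socket `stub_FROB` → `stub_ROOF0`, `--supports stmt-HodgeConjecture-24832`,
count-neutral): organ **(L-b) «DOWNSTAIRS CANCELLATION ROW»** of the ROOF-LEGS leaflet v3 (LA3-p01 (g2) 2026-09-02T05:29:28Z → A-p14 (g37)): in (r3₀-q) the law
`ψ_{Q,x̄″}^*λ″ = lamB ≫ [p]` is read off `ψ_P^*(ψ_Q^*λ″) = ψ_P^*(lamB ≫ [p])` by cancelling the cover `c̄ = ψ_P` on the left and its dual `c̄^∨` on the right.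
HC_CM is proved only modulo the printed citations (2 remaining named inputs hLiu418 24832, h413 24833) until rung 0 closes; this file is generic and changes no count.

THE MATHEMATICS.  `c̄ : A → B` a homomorphism of abelian `S`-schemes which is flat, surjective and quasi-compact (an fpqc cover, hence an EPIMORPHISM — ★
`cancel_left_of_flat_surjective`), with a quasi-inverse `ψ : B → A`, `ψ ≫ c̄ = [N]_B`, `N ≠ 0`; dual pairs `D`, `DB` with their unit pins over a reduced locally
Noetherian base.  Then `c̄^∨ : B̂ → Â` is RIGHT-CANCELLABLE against homomorphisms: `c̄^∨ ≫ ψ^∨ = (ψ ≫ c̄)^∨ = [N]^∨ = [N]_{B̂}` (★ `dualIsogenyOver_comp`, ★ `dualIsogenyOver_mulN`)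
and `[N]` is an fppf cover (★ `cancel_right_of_comp_eq_pow_id`).  Hence for homomorphisms `X, Y : B → B̂`:
`c̄ ≫ X ≫ c̄^∨ = c̄ ≫ Y ≫ c̄^∨ ⇒ X ≫ c̄^∨ = Y ≫ c̄^∨ ⇒ X = Y`.

* `dualIsogenyOver_comp_dualIsogenyOver_eq_pow_id_of_quasiInverse` — `c̄^∨ ≫ ψ^∨ = [N]_{B̂}`;
* `cancel_dualIsogenyOver_right_of_quasiInverse` — `X ≫ c̄^∨ = Y ≫ c̄^∨ ⇒ X = Y` (homomorphisms `X Y : C → B̂` out of any abelian scheme `C`);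
* **`eq_of_conj_dualIsogenyOver_eq`** — THE ROW: `c̄ ≫ X ≫ c̄^∨ = c̄ ≫ Y ≫ c̄^∨ ⇒ X = Y`.

## References
* [MumfordAV1970] D. Mumford, *Abelian Varieties* (1970), §7 Thm. 4 (p. 72), §8 (iv) (p. 75), §15 Thm. 1 (p. 143).
* [SGA1] A. Grothendieck, *SGA 1*, Exp. VIII Thm. 5.2 (fpqc morphisms are effective epimorphisms).
* [GortzWedhorn2023] U. Görtz, T. Wedhorn, *Algebraic Geometry II* (2023), Prop. 27.186 and Cor. 27.177 (1) (`[N]` is finite flat surjective).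
-/

set_option autoImplicit false

noncomputable section

universe u

open CategoryTheory CategoryTheory.Limits AlgebraicGeometry MonoidalCategory CartesianMonoidalCategory
open scoped MonObj

namespace Literature.AlgebraicGeometry.AbelianSchemes

namespace AbelianSchemeOver

variable {S : Scheme.{u}} [IsReduced S] [IsLocallyNoetherian S] {A B : AbelianSchemeOver S}
  (cbar : A.X ⟶ B.X) [IsMonHom cbar] (ψ : B.X ⟶ A.X) [IsMonHom ψ] {N : ℕ} (hN : N ≠ 0)
  (hψc : ψ ≫ cbar = (𝟙 B.X : B.X ⟶ B.X) ^ N)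
  (D : A.DualPair) (DB : B.DualPair)
  (hDB : Nonempty ((Scheme.Modules.pullback (DualPair.unitHatSlice DB)).obj DB.P ≅ SheafOfModules.unit _))

omit [IsReduced S] [IsLocallyNoetherian S] in
/-- `dualIsogenyOver` depends only on the morphism (rewriting under the instance argument).
[cite: MumfordAV1970, §15 Thm. 1 (p. 143)] -/
private theorem dualIsogenyOver_congr'' {ψ₁ ψ₂ : B.X ⟶ B.X} [h₁ : IsMonHom ψ₁] [h₂ : IsMonHom ψ₂] (h : ψ₁ = ψ₂) (D₁ D₂ : B.DualPair) :
    @DualPair.dualIsogenyOver S B B ψ₁ h₁ D₁ D₂ = @DualPair.dualIsogenyOver S B B ψ₂ h₂ D₁ D₂ := by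
  subst h; rfl

include hψc hDB in
/-- **`c̄^∨ ≫ ψ^∨ = [N]_{B̂}`** for a quasi-inverse pair `ψ ≫ c̄ = [N]_B` (`(ψ ≫ c̄)^∨ = c̄^∨ ≫ ψ^∨`, ★ `dualIsogenyOver_comp`; `[N]^∨ = [N]`, ★ `dualIsogenyOver_mulN`).
[cite: MumfordAV1970, §8 ((iv), p. 75) and §15 Thm. 1 (p. 143)] -/
theorem dualIsogenyOver_comp_dualIsogenyOver_eq_pow_id_of_quasiInverse :
    DualPair.dualIsogenyOver cbar D DB ≫ DualPair.dualIsogenyOver ψ DB D = (𝟙 DB.hat.X : DB.hat.X ⟶ DB.hat.X) ^ N := by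
  haveI : IsCommMonObj B.X := B.isCommMonObj_of_isReduced_base
  haveI : IsMonHom (B.mulN N) := B.isMonHom_mulN N
  rw [← DualPair.dualIsogenyOver_comp ψ cbar DB D DB, dualIsogenyOver_congr'' (hψc.trans (B.mulN_def N).symm) DB DB,
    DB.dualIsogenyOver_mulN hDB N, mulN_def]

include hN hψc hDB in
/-- **RIGHT CANCELLATION OF `c̄^∨`**: for homomorphisms `X, Y : C → B̂` out of an abelian scheme, `X ≫ c̄^∨ = Y ≫ c̄^∨ ⇒ X = Y` (★ `cancel_right_of_comp_eq_pow_id`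
with the quasi-inverse `ψ^∨`: `c̄^∨ ≫ ψ^∨ = [N]`, `N ≠ 0`). [cite: MumfordAV1970, §7 Thm. 4 (p. 72)] [cite: GortzWedhorn2023, Prop. 27.186 and Cor. 27.177 (1)] -/
theorem cancel_dualIsogenyOver_right_of_quasiInverse {C : AbelianSchemeOver S} (X Y : C.X ⟶ DB.hat.X) [IsMonHom X] [IsMonHom Y]
    (h : X ≫ DualPair.dualIsogenyOver cbar D DB = Y ≫ DualPair.dualIsogenyOver cbar D DB) : X = Y :=
  C.cancel_right_of_comp_eq_pow_id (DualPair.dualIsogenyOver cbar D DB) (DualPair.dualIsogenyOver ψ DB D) hN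
    (dualIsogenyOver_comp_dualIsogenyOver_eq_pow_id_of_quasiInverse cbar ψ hψc D DB hDB) X Y h

include hN hψc hDB in
/-- **THE DOWNSTAIRS CANCELLATION ROW: `c̄ ≫ X ≫ c̄^∨ = c̄ ≫ Y ≫ c̄^∨ ⇒ X = Y`** for homomorphisms `X, Y : B → B̂`, a flat surjective quasi-compact homomorphism
`c̄ : A → B` (an fpqc cover — an epimorphism, ★ `cancel_left_of_flat_surjective`) with a quasi-inverse `ψ ≫ c̄ = [N]_B`, `N ≠ 0` (so `c̄^∨` is right-cancellable,
`cancel_dualIsogenyOver_right_of_quasiInverse`).  The (r3₀-q) reading step of the L3 ROOF legs. [cite: MumfordAV1970, §7 Thm. 4 (p. 72) and §15 Thm. 1 (p. 143)]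
[cite: SGA1, Exp. VIII Thm. 5.2] -/
theorem eq_of_conj_dualIsogenyOver_eq [Flat cbar.left] [Surjective cbar.left] [QuasiCompact cbar.left]
    (X Y : B.X ⟶ DB.hat.X) [IsMonHom X] [IsMonHom Y]
    (h : cbar ≫ X ≫ DualPair.dualIsogenyOver cbar D DB = cbar ≫ Y ≫ DualPair.dualIsogenyOver cbar D DB) : X = Y :=
  cancel_dualIsogenyOver_right_of_quasiInverse cbar ψ hN hψc D DB hDB X Y (A.cancel_left_of_flat_surjective cbar h)

end AbelianSchemeOver

end Literature.AlgebraicGeometry.AbelianSchemes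

end
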